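import Literature.AlgebraicGeometry.Resolution.ProperModelsModification
import Literature.AlgebraicGeometry.Resolution.GraphClosureCompactification
import Literature.AlgebraicGeometry.Morphisms.NagataCompactification
import Literature.AlgebraicGeometry.Morphisms.ProperOpenPieceCartesian
import HarnessLib

/-!
# Extension of proper birational modifications over opens of proper models (from Nagata)

Topic: `Literature/AlgebraicGeometry/Resolution`. The compactification step of Zariski's
two-model patching for PROPER models of a function field (Piltant 2013, proof of Prop. 5.1,
Step 5: the scheme glued from local data over an open of a proper model is completed to a proper
model `Y/k` of `K`; Zariski–Samuel II, Ch. VI §17). Given Nagata's compactification theorem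
(NAMED FACT `NagataCompactification`, taken as a hypothesis):

* `exists_isPullback_of_nagata` — pure scheme theory: for a Noetherian scheme `X`, an open
  `U ⊆ X`, an integral scheme `Y` and a proper `g : Y → U`, there are an INTEGRAL scheme `Z`, a
  proper `ρ : Z → X` and a dense open immersion `s : Y → Z` with `Y = Z ×_X U`
  (`IsPullback s g ρ U.ι`). Construction: compactify `Y → U ⊆ X` over `X` (Nagata), replace the
  compactification by the closure of `Y` (`exists_graphClosure_compactification`), and use
  "open + proper ⇒ clopen ⇒ everything" (`isPullback_of_isOpenImmersion_of_universallyClosed`).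
* `ProperModel.exists_extension_of_nagata` — for a proper model `P` of `K/k`, an open
  `U ⊆ P`, an integral `Y` and a proper BIRATIONAL `g : Y → U`, there are a proper model `P'` of
  `K/k`, a morphism of models `φ : P' → P` and an open immersion `i : Y → P'.X` with
  `Y = P' ×_P U` (`IsPullback i g φ.f U.ι`): `ρ` is an isomorphism over the image in `P` of the
  iso-locus of `g` (`isIso_morphismRestrict_image_of_isPullback`), so `(Z, ρ)` is a proper model
  dominating `P` (`ProperModel.ofModification`).

## References

* O. Piltant, *An axiomatic version of Zariski's patching theorem*, RACSAM 107 (2013) 91–121,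
  proof of Prop. 5.1, Step 5. [Piltant2013]
* O. Zariski, P. Samuel, *Commutative Algebra* II, Ch. VI §17. [ZariskiSamuel1960]
* B. Conrad, *Deligne's notes on Nagata compactifications*, J. Ramanujan Math. Soc. 22 (2007),
  Thm. 4.1. [Conrad2007]
-/

noncomputable section

open CategoryTheory CategoryTheory.Limits AlgebraicGeometry TopologicalSpace Topology
open Literature.AlgebraicGeometry.Morphisms

namespace Literature.AlgebraicGeometry.Resolution

universe u

/-- **Proper integral extension over the base of a proper scheme over an open** (from Nagata).
Let `X` be a Noetherian scheme, `U ⊆ X` open, `Y` integral and `g : Y → U` proper. Then there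
are an integral scheme `Z`, a proper `ρ : Z → X` and an open immersion `s : Y → Z` with dense
image such that the square `s, g, ρ, U ↪ X` is cartesian (`Y = ρ⁻¹(U)`): compactify the
separated finite-type `Y → X` to `Y ↪ X̄ → X` (Nagata), let `Z ⊆ X̄` be the closure of `Y`
(scheme-theoretic image; `Y ↪ Z` is a dense open immersion), and observe that `Y → ρ⁻¹(U)` is an
open immersion which is proper (as `Y → U` is), hence has clopen non-empty image in the
irreducible `ρ⁻¹(U)`, hence is an isomorphism. [folklore] -/
theorem exists_isPullback_of_nagata (hN : NagataCompactification.{u}) {X : Scheme.{u}}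
    [IsNoetherian X] (U : X.Opens) {Y : Scheme.{u}} [IsIntegral Y] (g : Y ⟶ (U : Scheme.{u}))
    [IsProper g] :
    ∃ (Z : Scheme.{u}) (ρ : Z ⟶ X) (s : Y ⟶ Z), IsIntegral Z ∧ IsProper ρ ∧
      IsOpenImmersion s ∧ Dense (Set.range s) ∧ IsPullback s g ρ U.ι := by
  -- Nagata compactification of the separated finite-type `Y → U ⊆ X` over the qcqs `X`
  obtain ⟨Xc, j, gc, hj, hgc, hfac⟩ := hN Y X (g ≫ U.ι)
  haveI := hj
  haveI := hgc
  haveI : IsLocallyNoetherian Xc := LocallyOfFiniteType.isLocallyNoetherian gc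
  -- the closure `Z` of `Y` in the compactification
  obtain ⟨Z, c, s, hZ, hc, hsc, hs, hdense, -⟩ :=
    exists_graphClosure_compactification j (𝟙 Xc) j (Category.comp_id j)
  haveI := hZ
  haveI := hc
  haveI := hs
  have hsρ : s ≫ c ≫ gc = g ≫ U.ι := by rw [← Category.assoc, hsc, hfac]
  -- the clopen argument
  exact ⟨Z, c ≫ gc, s, hZ, inferInstance, hs, hdense,
    isPullback_of_isOpenImmersion_of_universallyClosed s g (c ≫ gc) U.ι hsρ⟩

namespace ProperModel

variable {k K : Type u} [Field k] [Field K] [Algebra k K]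

/-- **Extension of proper birational modifications over opens of proper models** (Piltant 2013,
proof of Prop. 5.1, Step 5: the glued scheme over an open of a proper model is completed to a
proper model of `K`; from Nagata's compactification theorem). Let `P` be a proper model of `K/k`,
`U ⊆ P` open, `Y` integral and `g : Y → U` proper and birational. Then there are a proper model
`P'` of `K/k`, a morphism of models `φ : P' → P` and an open immersion `i : Y → P'` such that
`Y = P' ×_P U` (`IsPullback i g φ.f U.ι`): take the integral proper extension `ρ : Z → P` of `g`
(`exists_isPullback_of_nagata`); `ρ` is an isomorphism over the image in `P` of the non-empty
iso-locus of `g`, so `(Z, ρ ≫ π_P)` is a proper model dominating `P`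
(`ProperModel.ofModification`). [cite: Piltant2013, proof of Prop. 5.1, Step 5] -/
theorem exists_extension_of_nagata (hN : NagataCompactification.{u}) (P : ProperModel k K)
    (U : P.X.Opens) (Y : Scheme.{u}) [IsIntegral Y] (g : Y ⟶ (U : Scheme.{u})) [IsProper g]
    (hg : IsBirational g) :
    ∃ (P' : ProperModel k K) (φ : P'.Hom P) (i : Y ⟶ P'.X), IsOpenImmersion i ∧
      IsPullback i g φ.f U.ι := by
  obtain ⟨Z, ρ, s, hZ, hρ, hs, -, hsq⟩ := exists_isPullback_of_nagata hN U g
  haveI := hZ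
  haveI := hρ
  haveI := hs
  -- `ρ` is an isomorphism over the image of the (non-empty) iso-locus of `g`
  obtain ⟨O, hOd, -, hO⟩ := hg
  haveI := hO
  haveI : Nonempty (U : Scheme.{u}) := ⟨g (Classical.arbitrary Y)⟩
  have hne : (U.ι ''ᵁ O : Set P.X).Nonempty := nonempty_image_ι U hOd.nonempty
  haveI : IsIso (ρ ∣_ (U.ι ''ᵁ O)) := isIso_morphismRestrict_image_of_isPullback hsq O
  exact ⟨ofModification P ρ (U.ι ''ᵁ O) hne, ofModificationHom P ρ (U.ι ''ᵁ O) hne, s, hs, hsq⟩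

end ProperModel

end Literature.AlgebraicGeometry.Resolution

end
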